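import Summits.QuantumFields.YangMills.Theorems.BalabanUVNodesPortS1P0CInterface
import Summits.QuantumFields.YangMills.Theorems.BalabanUVNodesPortS1P0CBridge
import Summits.QuantumFields.YangMills.Theorems.BalabanUVNodesPortS1P0CRadius

/-!
# NODE O port — `stub_P0C` (the guarded P0-ℂ letter `P0HolExtAtRecordGL`), brick H: THE SUPPLIER INTERFACE AT FAMILY LEVEL
# (memo `Cruxes/PortRecordRepresentationS1/Lines/pta_residueW-stub_P0C-hand.md` §3 R7, §4; = brick F ✓`p0CarrierClauses_of_family` with its piece-level (Z-bridge) discharged by brick G ✓`p0cPiece_bridge`)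

Porter hand `hand-27930-P0C` (g0), `--supports stmt-QuantumFields-27930 --as helper`; count-neutral.  [I] = [Balaban1987RG1], [15] = [Balaban1985Variational], [16] = [Balaban1985UV3].

WHAT.  ★ `p0CarrierClauses_of_families` — the body `P0CarrierClauses` of `stub_P0C`'s letter for `(TC, TY, TZY) := (T · X_full, Möbius pieces of T, integer Möbius pieces of TZ)` from
hypotheses on the two FAMILIES only (plus the decay of the torus pieces, the genuine estimate, and (P5) verbatim): (Z-supp)(Z-loc)(Z-cov) for `TZ`; the family-level bridge «`T_Y` at covered
indices of the window of `Y` = `TZ_{X̂_K(Y)}` at the pull-back» off the centred wrap class ([I] (1.21)); (P2) for `T · X_full`; (P3)(P4-b)(P4-c)(P4-d) and (P5ᶜ)-coercivity for `T`.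
Needs the catalogue guard `McGuard F Mc` (the letter's own binder) for the cover geometry.  ★ `p0Body_of_families` — the WHOLE BODY of `P0HolExtAtRecordGL` (`P0CarrierClauses … ∧
P0CarrierLatticeDecay …`) from the same family hypotheses with the decay row stated ONCE, in the lattice-weighted form (P4-lat) for the torus pieces ((P4-e) follows by ✓`schur_of_latticeDecay`,
brick B).  So, kernel-checked: `stub_P0C` = «construct the X-localized holomorphic (2.11) kernels on the
torus catalogue and on the integer windows with these eleven family properties, and prove the Schur ∕ lattice-Schur DECAY of the torus Möbius pieces» — the memo's (M1)–(M5); (M6) is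
reduced to the family-level periodisation identity.

HONEST FRAMING.  A reduction; NO estimate; nothing of Bałaban asserted, ported or discharged; the hypotheses are inhabited NOWHERE today; `stub_P0C` NOT closed; ⟨27930⟩ OPEN; NODE O 0∕1;
COUNT 8∕28 · K 1∕4 UNMOVED; finite `𝕋⁴_{L^K}` at fixed ε — NOT continuum ∕ OS ∕ Clay; **the Yang–Mills mass gap is NOT proved by any of this.**  No `sorry`, no `instance`, no
`notation`, no `def`; standard axioms.
-/

noncomputable section

open scoped BigOperators Matrix.Norms.L2Operator Topology
open Filter Finset

namespace Summit.QuantumFields.YangMills.Theorems.BalabanUVNodesPortS1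

open Summit.QuantumFields.YangMills.Theorems.K0RecordFormatNames
open Literature.MathematicalPhysics.QuantumFieldTheory.Balaban1983to89
open Literature.MathematicalPhysics.QuantumFieldTheory.Balaban1983to89.Node00
open Literature.MathematicalPhysics.QuantumFieldTheory.Balaban1983to89.T4Continuum (T4Family)
open Literature.MathematicalPhysics.QuantumLattice (blockMap)

variable (F : T4Family)

/-- ★ **THE SUPPLIER INTERFACE AT FAMILY LEVEL**: `P0CarrierClauses` for the Möbius carriers from hypotheses on the torus family `T` and the integer family `TZ` (+ decay of the torus pieces,
(P5) verbatim).  See ✓`p0CarrierClauses_of_family` (brick F) for the dictionary; the (Z-bridge) is now the family-level periodisation identity, discharged to the pieces by ✓`p0cPiece_bridge`.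
[cite: Balaban1987RG1, (1.7) p.261, (1.10) p.262, (1.19) p.263, (1.21) p.264, (2.11) p.267; Balaban1985Variational, Prop. 9 p.309, Thm 1 p.279; Balaban1985UV3, (23) p.262] -/
theorem p0CarrierClauses_of_families (a₀ δ₀ c₀ γ₀ γ₁ : ℝ) {Mc : ℕ} (hMc : McGuard F Mc) (α₀ α₁ ε₂₉ : ℝ) (k : ℕ)
    (T : (n : ℕ) → (recordDomSys F Mc k (recordK₀ F Mc k + n)).Dom → Sect2.CPair (F.P (recordK₀ F Mc k + n)) (MatA 2) →
        FluctIdx F k (recordK₀ F Mc k + n) → FluctIdx F k (recordK₀ F Mc k + n) → ℂ)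
    (TZ : P0CIntDom → IntBondCfg → P0CIntIdx → P0CIntIdx → ℂ)
    (AdM : (n : ℕ) → (Site (F.P (recordK₀ F Mc k + n)) 0 → (MatA 2)ˣ) →
        Matrix (FluctIdx F k (recordK₀ F Mc k + n)) (FluctIdx F k (recordK₀ F Mc k + n)) ℂ)
    (AdZ : ((Fin 4 → ℤ) → (MatA 2)ˣ) → (Fin 4 → ℤ) × Fin 4 → Matrix (Fin 3) (Fin 3) ℂ)
    -- (Z-supp) for the integer family
    (hZsupp : ∀ (X : P0CIntDom) (f : IntBondCfg) (bi bj : (Fin 4 → ℤ) × Fin 4) (a a' : Fin 3),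
      (blockMap (F.L * Mc) bi.1 ∉ X.1 ∨ blockMap (F.L * Mc) bj.1 ∉ X.1) → TZ X f (bi, a) (bj, a') = 0)
    -- (Z-loc) for the integer family
    (hZloc : ∀ (X : P0CIntDom) (f f' : IntBondCfg),
      (∀ zμ : (Fin 4 → ℤ) × Fin 4, zμ.1 ∈ (⋃ a ∈ X.1, B14.Eq213MaximalDomains.cubeExt (F.L ^ (k + 1) * Mc) a 0) →
        Function.update zμ.1 zμ.2 (zμ.1 zμ.2 + 1) ∈ (⋃ a ∈ X.1, B14.Eq213MaximalDomains.cubeExt (F.L ^ (k + 1) * Mc) a 0) → f zμ = f' zμ) → TZ X f = TZ X f')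
    -- (Z-cov) for the integer family
    (hZcov : ∀ û : (Fin 4 → ℤ) → (MatA 2)ˣ, (∀ z, û z ∈ (B12RegularSpaces111SpecialUnitary.suModel 2).Gc) →
      (∀ b : (Fin 4 → ℤ) × Fin 4, IsUnit (AdZ û b)) ∧
      ∀ (X : P0CIntDom) (f : IntBondCfg) (bi bj : (Fin 4 → ℤ) × Fin 4),
        (Matrix.of fun a a' : Fin 3 => TZ X (intGaugeAct û f) (bi, a) (bj, a')) =
          AdZ û bi * (Matrix.of fun a a' : Fin 3 => TZ X f (bi, a) (bj, a')) * (AdZ û bj)⁻¹)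
    -- (Z-bridge) for the FAMILIES (off the centred wrap class, at covered indices of the window): [I] (1.21)
    (hfam : ∀ (n : ℕ) (Y : (recordDomSys F Mc k (recordK₀ F Mc k + n)).Dom) (hY : Y ∉ recordWrapCtr F Mc k (recordK₀ F Mc k + n))
        (φ : Sect2.CPair (F.P (recordK₀ F Mc k + n)) (MatA 2)) (bi bj : (Fin 4 → ℤ) × Fin 4) (a a' : Fin 3),
      blockMap (F.L * Mc) bi.1 ∈ intCubes F Mc k (recordK₀ F Mc k + n) Y → blockMap (F.L * Mc) bj.1 ∈ intCubes F Mc k (recordK₀ F Mc k + n) Y →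
        T n Y φ (coverBondAt (F.P (recordK₀ F Mc k + n)) k bi, a) (coverBondAt (F.P (recordK₀ F Mc k + n)) k bj, a') =
          TZ ⟨intCubes F Mc k (recordK₀ F Mc k + n) Y, intCubes_mem_p0cIntDom hY⟩ (pullPair F (recordK₀ F Mc k + n) φ) (bi, a) (bj, a'))
    -- (P2) germ identity for the whole-torus member
    (hP2 : letI θ := thetaFill F a₀ ε₂₉; letI := θ.instVβ₁; letI := θ.instVβ₂; letI := θ.instιβ
      ∀ n : ℕ, ∀ᶠ B in 𝓝 (0 : recordW F a₀ ε₂₉ k (recordK₀ F Mc k + n)),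
        ∀ i j : NonB0Idx F k (recordK₀ F Mc k + n),
          T n (g3cFull F Mc k (recordK₀ F Mc k + n)) (recordPairJ F θ k (recordK₀ F Mc k + n) B) i.1 j.1 =
            ((recordPreckLoc F k (recordK₀ F Mc k + n) a₀ (portVkAx F a₀ ε₂₉ k (recordK₀ F Mc k + n) B)
              (hopLinGraph F k (recordK₀ F Mc k + n) (portVkAx F a₀ ε₂₉ k (recordK₀ F Mc k + n) B)) i j : ℝ) : ℂ))
    -- (P3) covariance for the family
    (hP3 : ∀ (n : ℕ) (u : Site (F.P (recordK₀ F Mc k + n)) 0 → (MatA 2)ˣ),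
      IsUnit (AdM n u) ∧ (∀ i j : FluctIdx F k (recordK₀ F Mc k + n), i.1 ≠ j.1 → AdM n u i j = 0) ∧
      ∀ (X : (recordDomSys F Mc k (recordK₀ F Mc k + n)).Dom) (φ : Sect2.CPair (F.P (recordK₀ F Mc k + n)) (MatA 2)),
        Matrix.of (T n X (Sect2.cAct u φ)) = AdM n u * Matrix.of (T n X φ) * (AdM n u)⁻¹)
    -- (P4-b) support for the family
    (hsupp : ∀ (n : ℕ) (X : (recordDomSys F Mc k (recordK₀ F Mc k + n)).Dom) (φ : Sect2.CPair (F.P (recordK₀ F Mc k + n)) (MatA 2))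
        (i j : FluctIdx F k (recordK₀ F Mc k + n)),
      (B15DeterminingSets.embIter k i.1.src ∉ Sect2.domSites (F.P (recordK₀ F Mc k + n)) Mc (k + 1) X ∨
        B15DeterminingSets.embIter k j.1.src ∉ Sect2.domSites (F.P (recordK₀ F Mc k + n)) Mc (k + 1) X) → T n X φ i j = 0)
    -- (P4-c) (1.7)-locality for the family
    (hloc : ∀ (n : ℕ) (X : (recordDomSys F Mc k (recordK₀ F Mc k + n)).Dom) (φ ψ : Sect2.CPair (F.P (recordK₀ F Mc k + n)) (MatA 2)),
      Sect2.agreeOnSet (Sect2.domSites (F.P (recordK₀ F Mc k + n)) Mc (k + 1) X) φ ψ → T n X φ = T n X ψ)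
    -- (P4-d) analyticity on the record space for the family
    (han : ∀ (n : ℕ) (X : (recordDomSys F Mc k (recordK₀ F Mc k + n)).Dom) (φ : Sect2.CPair (F.P (recordK₀ F Mc k + n)) (MatA 2)),
      encodeCfg F (recordK₀ F Mc k + n) φ ∈ recordUc F Mc k α₀ α₁ (recordK₀ F Mc k + n) X →
        ∀ i j : FluctIdx F k (recordK₀ F Mc k + n), AnalyticAt ℂ (fun ψ : Sect2.CPair (F.P (recordK₀ F Mc k + n)) (MatA 2) => T n X ψ i j) φ)
    -- (P4-e) Schur decay for the PIECES (the estimate)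
    (hdecay : ∀ (n : ℕ) (Y : (recordDomSys F Mc k (recordK₀ F Mc k + n)).Dom) (φ : Sect2.CPair (F.P (recordK₀ F Mc k + n)) (MatA 2)),
      encodeCfg F (recordK₀ F Mc k + n) φ ∈ recordUc F Mc k α₀ α₁ (recordK₀ F Mc k + n) Y →
        (∀ i : FluctIdx F k (recordK₀ F Mc k + n),
          ∑ j : FluctIdx F k (recordK₀ F Mc k + n), ‖p0cPiece F Mc k (recordK₀ F Mc k + n) (T n) Y φ i j‖ ≤
            c₀ * Real.exp (-(δ₀ * (recordDomSys F Mc k (recordK₀ F Mc k + n)).dj Y))) ∧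
        (∀ j : FluctIdx F k (recordK₀ F Mc k + n),
          ∑ i : FluctIdx F k (recordK₀ F Mc k + n), ‖p0cPiece F Mc k (recordK₀ F Mc k + n) (T n) Y φ i j‖ ≤
            c₀ * Real.exp (-(δ₀ * (recordDomSys F Mc k (recordK₀ F Mc k + n)).dj Y))))
    -- (P5) verbatim (carrier-free)
    (hP5 : letI θ := thetaFill F a₀ ε₂₉; letI := θ.instVβ₁; letI := θ.instVβ₂; letI := θ.instιβ
      ∀ n : ℕ, ∀ᶠ B in 𝓝 (0 : recordW F a₀ ε₂₉ k (recordK₀ F Mc k + n)),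
        (recordPreckLoc F k (recordK₀ F Mc k + n) a₀ (portVkAx F a₀ ε₂₉ k (recordK₀ F Mc k + n) B)
            (hopLinGraph F k (recordK₀ F Mc k + n) (portVkAx F a₀ ε₂₉ k (recordK₀ F Mc k + n) B))).PosDef ∧
        ∀ v : NonB0Idx F k (recordK₀ F Mc k + n) → ℝ,
          γ₀ * dotProduct v v ≤
              dotProduct v (Matrix.mulVec (recordPreckLoc F k (recordK₀ F Mc k + n) a₀ (portVkAx F a₀ ε₂₉ k (recordK₀ F Mc k + n) B)
                (hopLinGraph F k (recordK₀ F Mc k + n) (portVkAx F a₀ ε₂₉ k (recordK₀ F Mc k + n) B))) v) ∧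
            dotProduct v (Matrix.mulVec (recordPreckLoc F k (recordK₀ F Mc k + n) a₀ (portVkAx F a₀ ε₂₉ k (recordK₀ F Mc k + n) B)
                (hopLinGraph F k (recordK₀ F Mc k + n) (portVkAx F a₀ ε₂₉ k (recordK₀ F Mc k + n) B))) v) ≤
              γ₁ * dotProduct v v)
    -- (P5ᶜ) complex coercivity for the family
    (hcoer : ∀ (n : ℕ) (X : (recordDomSys F Mc k (recordK₀ F Mc k + n)).Dom) (φ : Sect2.CPair (F.P (recordK₀ F Mc k + n)) (MatA 2)),
      encodeCfg F (recordK₀ F Mc k + n) φ ∈ recordUc F Mc k α₀ α₁ (recordK₀ F Mc k + n) X →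
        ∀ v : NonB0Idx F k (recordK₀ F Mc k + n) → ℂ,
          (∀ i : NonB0Idx F k (recordK₀ F Mc k + n),
            B15DeterminingSets.embIter k i.1.1.src ∉ Sect2.domSites (F.P (recordK₀ F Mc k + n)) Mc (k + 1) X → v i = 0) →
          γ₀ * (∑ i, ‖v i‖ ^ 2) ≤ (∑ i, ∑ j, star (v i) * T n X φ i.1 j.1 * v j).re) :
    P0CarrierClauses F a₀ δ₀ c₀ γ₀ γ₁ Mc α₀ α₁ ε₂₉ k
      (fun n => T n (g3cFull F Mc k (recordK₀ F Mc k + n)))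
      (fun n => p0cPiece F Mc k (recordK₀ F Mc k + n) (T n))
      (p0cIntPiece TZ) AdM AdZ :=
  p0CarrierClauses_of_family F a₀ δ₀ c₀ γ₀ γ₁ Mc α₀ α₁ ε₂₉ k T TZ AdM AdZ hZsupp hZloc hZcov
    (fun n Y hY φ bi bj a a' hbi hbj =>
      p0cPiece_bridge hMc (Nat.le_add_right _ _) (T n) TZ (hsupp n) hZsupp (fun Y' hY' ψ => hfam n Y' hY' ψ) φ Y hY bi bj a a' hbi hbj)
    hP2 hP3 hsupp hloc han hdecay hP5 hcoer


/-- ★ **THE WHOLE BODY OF `P0HolExtAtRecordGL` FROM THE FAMILIES**: `P0CarrierClauses … ∧ P0CarrierLatticeDecay …` for the Möbius carriers, the decay row stated once in its lattice-weighted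
form (P4-lat) (`0 ≤ δ₁`; (P4-e) by ✓`schur_of_latticeDecay`).  What a supplier of `stub_P0C` proves, row by row, is exactly this hypothesis list under the letter's (Q-ord) prefix.
[cite: Balaban1987RG1, (2.11) p.267, (1.7) p.261, (1.21) p.264; Balaban1985Variational, Prop. 9 p.309; Balaban1985BackgroundPropagators, (3.42) p.399, (3.94) p.410] -/
theorem p0Body_of_families (a₀ δ₀ c₀ γ₀ γ₁ δ₁ : ℝ) (hδ₁ : 0 ≤ δ₁) {Mc : ℕ} (hMc : McGuard F Mc) (α₀ α₁ ε₂₉ : ℝ) (k : ℕ)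
    (T : (n : ℕ) → (recordDomSys F Mc k (recordK₀ F Mc k + n)).Dom → Sect2.CPair (F.P (recordK₀ F Mc k + n)) (MatA 2) →
        FluctIdx F k (recordK₀ F Mc k + n) → FluctIdx F k (recordK₀ F Mc k + n) → ℂ)
    (TZ : P0CIntDom → IntBondCfg → P0CIntIdx → P0CIntIdx → ℂ)
    (AdM : (n : ℕ) → (Site (F.P (recordK₀ F Mc k + n)) 0 → (MatA 2)ˣ) →
        Matrix (FluctIdx F k (recordK₀ F Mc k + n)) (FluctIdx F k (recordK₀ F Mc k + n)) ℂ)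
    (AdZ : ((Fin 4 → ℤ) → (MatA 2)ˣ) → (Fin 4 → ℤ) × Fin 4 → Matrix (Fin 3) (Fin 3) ℂ)
    -- (Z-supp) for the integer family
    (hZsupp : ∀ (X : P0CIntDom) (f : IntBondCfg) (bi bj : (Fin 4 → ℤ) × Fin 4) (a a' : Fin 3),
      (blockMap (F.L * Mc) bi.1 ∉ X.1 ∨ blockMap (F.L * Mc) bj.1 ∉ X.1) → TZ X f (bi, a) (bj, a') = 0)
    -- (Z-loc) for the integer family
    (hZloc : ∀ (X : P0CIntDom) (f f' : IntBondCfg),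
      (∀ zμ : (Fin 4 → ℤ) × Fin 4, zμ.1 ∈ (⋃ a ∈ X.1, B14.Eq213MaximalDomains.cubeExt (F.L ^ (k + 1) * Mc) a 0) →
        Function.update zμ.1 zμ.2 (zμ.1 zμ.2 + 1) ∈ (⋃ a ∈ X.1, B14.Eq213MaximalDomains.cubeExt (F.L ^ (k + 1) * Mc) a 0) → f zμ = f' zμ) → TZ X f = TZ X f')
    -- (Z-cov) for the integer family
    (hZcov : ∀ û : (Fin 4 → ℤ) → (MatA 2)ˣ, (∀ z, û z ∈ (B12RegularSpaces111SpecialUnitary.suModel 2).Gc) →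
      (∀ b : (Fin 4 → ℤ) × Fin 4, IsUnit (AdZ û b)) ∧
      ∀ (X : P0CIntDom) (f : IntBondCfg) (bi bj : (Fin 4 → ℤ) × Fin 4),
        (Matrix.of fun a a' : Fin 3 => TZ X (intGaugeAct û f) (bi, a) (bj, a')) =
          AdZ û bi * (Matrix.of fun a a' : Fin 3 => TZ X f (bi, a) (bj, a')) * (AdZ û bj)⁻¹)
    -- (Z-bridge) for the FAMILIES (off the centred wrap class, at covered indices of the window): [I] (1.21)
    (hfam : ∀ (n : ℕ) (Y : (recordDomSys F Mc k (recordK₀ F Mc k + n)).Dom) (hY : Y ∉ recordWrapCtr F Mc k (recordK₀ F Mc k + n))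
        (φ : Sect2.CPair (F.P (recordK₀ F Mc k + n)) (MatA 2)) (bi bj : (Fin 4 → ℤ) × Fin 4) (a a' : Fin 3),
      blockMap (F.L * Mc) bi.1 ∈ intCubes F Mc k (recordK₀ F Mc k + n) Y → blockMap (F.L * Mc) bj.1 ∈ intCubes F Mc k (recordK₀ F Mc k + n) Y →
        T n Y φ (coverBondAt (F.P (recordK₀ F Mc k + n)) k bi, a) (coverBondAt (F.P (recordK₀ F Mc k + n)) k bj, a') =
          TZ ⟨intCubes F Mc k (recordK₀ F Mc k + n) Y, intCubes_mem_p0cIntDom hY⟩ (pullPair F (recordK₀ F Mc k + n) φ) (bi, a) (bj, a'))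
    -- (P2) germ identity for the whole-torus member
    (hP2 : letI θ := thetaFill F a₀ ε₂₉; letI := θ.instVβ₁; letI := θ.instVβ₂; letI := θ.instιβ
      ∀ n : ℕ, ∀ᶠ B in 𝓝 (0 : recordW F a₀ ε₂₉ k (recordK₀ F Mc k + n)),
        ∀ i j : NonB0Idx F k (recordK₀ F Mc k + n),
          T n (g3cFull F Mc k (recordK₀ F Mc k + n)) (recordPairJ F θ k (recordK₀ F Mc k + n) B) i.1 j.1 =
            ((recordPreckLoc F k (recordK₀ F Mc k + n) a₀ (portVkAx F a₀ ε₂₉ k (recordK₀ F Mc k + n) B)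
              (hopLinGraph F k (recordK₀ F Mc k + n) (portVkAx F a₀ ε₂₉ k (recordK₀ F Mc k + n) B)) i j : ℝ) : ℂ))
    -- (P3) covariance for the family
    (hP3 : ∀ (n : ℕ) (u : Site (F.P (recordK₀ F Mc k + n)) 0 → (MatA 2)ˣ),
      IsUnit (AdM n u) ∧ (∀ i j : FluctIdx F k (recordK₀ F Mc k + n), i.1 ≠ j.1 → AdM n u i j = 0) ∧
      ∀ (X : (recordDomSys F Mc k (recordK₀ F Mc k + n)).Dom) (φ : Sect2.CPair (F.P (recordK₀ F Mc k + n)) (MatA 2)),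
        Matrix.of (T n X (Sect2.cAct u φ)) = AdM n u * Matrix.of (T n X φ) * (AdM n u)⁻¹)
    -- (P4-b) support for the family
    (hsupp : ∀ (n : ℕ) (X : (recordDomSys F Mc k (recordK₀ F Mc k + n)).Dom) (φ : Sect2.CPair (F.P (recordK₀ F Mc k + n)) (MatA 2))
        (i j : FluctIdx F k (recordK₀ F Mc k + n)),
      (B15DeterminingSets.embIter k i.1.src ∉ Sect2.domSites (F.P (recordK₀ F Mc k + n)) Mc (k + 1) X ∨
        B15DeterminingSets.embIter k j.1.src ∉ Sect2.domSites (F.P (recordK₀ F Mc k + n)) Mc (k + 1) X) → T n X φ i j = 0)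
    -- (P4-c) (1.7)-locality for the family
    (hloc : ∀ (n : ℕ) (X : (recordDomSys F Mc k (recordK₀ F Mc k + n)).Dom) (φ ψ : Sect2.CPair (F.P (recordK₀ F Mc k + n)) (MatA 2)),
      Sect2.agreeOnSet (Sect2.domSites (F.P (recordK₀ F Mc k + n)) Mc (k + 1) X) φ ψ → T n X φ = T n X ψ)
    -- (P4-d) analyticity on the record space for the family
    (han : ∀ (n : ℕ) (X : (recordDomSys F Mc k (recordK₀ F Mc k + n)).Dom) (φ : Sect2.CPair (F.P (recordK₀ F Mc k + n)) (MatA 2)),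
      encodeCfg F (recordK₀ F Mc k + n) φ ∈ recordUc F Mc k α₀ α₁ (recordK₀ F Mc k + n) X →
        ∀ i j : FluctIdx F k (recordK₀ F Mc k + n), AnalyticAt ℂ (fun ψ : Sect2.CPair (F.P (recordK₀ F Mc k + n)) (MatA 2) => T n X ψ i j) φ)
    -- (P4-lat) lattice-weighted Schur decay for the torus PIECES (the estimate; (P4-e) follows)
    (hLat : P0CarrierLatticeDecay F δ₀ c₀ δ₁ Mc α₀ α₁ k (fun n => p0cPiece F Mc k (recordK₀ F Mc k + n) (T n)))
    -- (P5) verbatim (carrier-free)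
    (hP5 : letI θ := thetaFill F a₀ ε₂₉; letI := θ.instVβ₁; letI := θ.instVβ₂; letI := θ.instιβ
      ∀ n : ℕ, ∀ᶠ B in 𝓝 (0 : recordW F a₀ ε₂₉ k (recordK₀ F Mc k + n)),
        (recordPreckLoc F k (recordK₀ F Mc k + n) a₀ (portVkAx F a₀ ε₂₉ k (recordK₀ F Mc k + n) B)
            (hopLinGraph F k (recordK₀ F Mc k + n) (portVkAx F a₀ ε₂₉ k (recordK₀ F Mc k + n) B))).PosDef ∧
        ∀ v : NonB0Idx F k (recordK₀ F Mc k + n) → ℝ,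
          γ₀ * dotProduct v v ≤
              dotProduct v (Matrix.mulVec (recordPreckLoc F k (recordK₀ F Mc k + n) a₀ (portVkAx F a₀ ε₂₉ k (recordK₀ F Mc k + n) B)
                (hopLinGraph F k (recordK₀ F Mc k + n) (portVkAx F a₀ ε₂₉ k (recordK₀ F Mc k + n) B))) v) ∧
            dotProduct v (Matrix.mulVec (recordPreckLoc F k (recordK₀ F Mc k + n) a₀ (portVkAx F a₀ ε₂₉ k (recordK₀ F Mc k + n) B)
                (hopLinGraph F k (recordK₀ F Mc k + n) (portVkAx F a₀ ε₂₉ k (recordK₀ F Mc k + n) B))) v) ≤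
              γ₁ * dotProduct v v)
    -- (P5ᶜ) complex coercivity for the family
    (hcoer : ∀ (n : ℕ) (X : (recordDomSys F Mc k (recordK₀ F Mc k + n)).Dom) (φ : Sect2.CPair (F.P (recordK₀ F Mc k + n)) (MatA 2)),
      encodeCfg F (recordK₀ F Mc k + n) φ ∈ recordUc F Mc k α₀ α₁ (recordK₀ F Mc k + n) X →
        ∀ v : NonB0Idx F k (recordK₀ F Mc k + n) → ℂ,
          (∀ i : NonB0Idx F k (recordK₀ F Mc k + n),
            B15DeterminingSets.embIter k i.1.1.src ∉ Sect2.domSites (F.P (recordK₀ F Mc k + n)) Mc (k + 1) X → v i = 0) →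
          γ₀ * (∑ i, ‖v i‖ ^ 2) ≤ (∑ i, ∑ j, star (v i) * T n X φ i.1 j.1 * v j).re) :
    P0CarrierClauses F a₀ δ₀ c₀ γ₀ γ₁ Mc α₀ α₁ ε₂₉ k
        (fun n => T n (g3cFull F Mc k (recordK₀ F Mc k + n)))
        (fun n => p0cPiece F Mc k (recordK₀ F Mc k + n) (T n))
        (p0cIntPiece TZ) AdM AdZ ∧
      P0CarrierLatticeDecay F δ₀ c₀ δ₁ Mc α₀ α₁ k (fun n => p0cPiece F Mc k (recordK₀ F Mc k + n) (T n)) :=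
  ⟨p0CarrierClauses_of_families F a₀ δ₀ c₀ γ₀ γ₁ hMc α₀ α₁ ε₂₉ k T TZ AdM AdZ hZsupp hZloc hZcov hfam hP2 hP3 hsupp hloc han
    (fun n Y φ hφ => schur_of_latticeDecay F hLat hδ₁ n Y φ hφ) hP5 hcoer, hLat⟩

end Summit.QuantumFields.YangMills.Theorems.BalabanUVNodesPortS1

end
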